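import Literature.AlgebraicGeometry.HodgeTheory.WeilFamilyReachOfMonodromy
import Literature.AlgebraicGeometry.HodgeTheory.WeilFamilyKAction
import Literature.AlgebraicGeometry.HodgeTheory.HyperbolicWeilTypeBalanced
import HarnessLib

/-!
# The hyperbolic Weil-family facts from the bare construction: no Hodge theory along the family is owed

Family `hodge`, layer `Literature/AlgebraicGeometry/HodgeTheory`; theorems only (no definition, no
named fact; D-0026). Third reduction step for the named facts `weilFamilyReach_hyperbolic`
(`HodgeTheory/WeilFamilyReach`) and `weilFamily_hyperbolic_weilSystem_reach`
(`HodgeTheory/WeilFamilyReachSystem`), after `WeilFamilyReachOfSystem` (the reach fact is the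
family-first fact plus its polarization class) and `WeilFamilyReachOfMonodromy` (both facts follow
from the OUTPUTS of the construction in the proof of [Deligne1982HodgeCycles, Thm. 4.8]: the abelian
scheme with `K`-action over the hyperbolic component, balanced fibres, special-unitary monodromy,
reach by `K`-isogeny, one polarization equation).

Of the six clauses of the hypothesis of `polarizedWeilSystem_of_unitaryMonodromyFamily`, clause (3)
— "for all `s ∈ S`, `(Y_s, ν_s)` satisfies the equivalent statements in (4.4)", i.e. EVERY fibre is
of balanced Weil type `(n, n)`, `dim (V₊(Y_s) ∩ H^{1,0}) = n` — is the only one that is Hodge theory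
rather than construction, and it is now a THEOREM of the other clauses:

* at the base point it holds because `(P, ψ₀)` is HYPERBOLIC: "(b) implies (4.4)"
  ([Deligne1982HodgeCycles], p. 48–49: `φ_τ` is definite of opposite signs on `H^{-1,0}_τ` and
  `H^{0,-1}_τ`, so a split `φ` forces `a_σ = b_σ = d/2`; [vanGeemen1994HodgeAV, Lemma 5.2 (1)]),
  `finrank_eigenspace_inf_hodgeOneZero_eq_of_isHyperbolicWeilType`
  (`HodgeTheory/HyperbolicWeilTypeBalanced`), read on the fibre `𝒳_{s₀}` through the chart `e'`
  (`finrank_eigenspace_inf_hodgeOneZero_eq_of_iso`);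
* it PROPAGATES along the paths of the connected base because the `K`-Hermitian form has constant
  signature in the family ([vanGeemen1994HodgeAV, Lemma 5.2 (4)]; Hodge–Riemann signs in degree
  one transported in the local system `R¹ f_* ℂ`, which commutes with the global `√-d`),
  `finrank_eigenspace_inf_hodgeOneZero_eq_of_path'` (`HodgeTheory/WeilFamilyBalanced`,
  `HodgeTheory/WeilFamilyKAction`), and is read on `(Y_s, Ψ_s)` through the chart `ε_s`.

The reach clause (5) is likewise accepted in the form a construction delivers it — a `K`-LINEAR
ISOGENY `u : Y_s → A` from some fibre chart (`IsIsogeny u`, `u ∘ Ψ_s = φ ∘ u`;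
[vanGeemen1994HodgeAV, 5.3–5.4 and 5.8–5.10]: split Hermitian `K`-spaces of equal rank are
isometric, [Deligne1982HodgeCycles, Cor. 4.2], the domain `X⁺` is connected, and commensurable
lattices give an isogeny) — and the recorded pair `(u, v, m)` with `u` flat, `v ∘ u = [m]`,
`m ≥ 1`, `v` `K`-linear is DERIVED from the tree's isogeny theory: the quasi-inverse
(`IsIsogeny.exists_nsmul_inverse_holds`, Mumford §19 Remark p. 169), flatness of isogenies
(`IsIsogeny.flat`, [Milne1986AbelianVarieties, §8 Prop. 8.1]) and cancellation of the epimorphism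
`u` (`IsIsogeny.cancel_left`) — `exists_isogenyPair_of_isIsogeny_of_comm`.

* `unitaryMonodromyFamily_of_construction` — the bare construction package (family clauses;
  global `√-d` `g` with the base chart `e' : P ≅ 𝒳_{s₀}` and fibre charts
  `ε_s : Y_s ≅ 𝒳_s`, `Ψ_s² = -d`, all intertwining; special-unitary monodromy at `s₀`; reach by a
  `K`-linear isogeny; the polarization equation at `s₀`) implies the hypothesis of
  `polarizedWeilSystem_of_unitaryMonodromyFamily` verbatim;
* `weilFamilyReach_hyperbolic_of_construction`,
  `weilFamily_hyperbolic_weilSystem_reach_of_construction` — hence both named facts.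

So what the two facts still owe is the CONSTRUCTION and nothing else: the universal abelian scheme
with `𝒪_K`-action over the neat arithmetic quotient `Γ\X⁺` of the `U(n, n)`-domain through
`(P, ψ₀, h_K)`, projectively embedded by a power of its polarization ([Deligne1982HodgeCycles],
proof of Thm. 4.8, pp. 48–50, Remark 4.9; [MumfordFogartyKirwan1994, Thm. 7.9–7.10]; Baily–Borel
and Borel for the algebraicity of `Γ\X⁺`), its monodromy `Γ ⊂ SU(Λ, H)` (level `n ≥ 3`:
`det_E γ ≡ 1 mod n` forces `det_E γ = 1`, p. 50; [vanGeemen1994HodgeAV, 5.11]) and the period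
point of every hyperbolic `(A, φ)` up to `K`-isogeny (complex uniformisation `A(ℂ) ≅ V_ℝ/Λ`). The
tree constructs no moduli space of abelian varieties, no universal abelian scheme and no period
map (2026-08-16).

## References

* [Deligne1982HodgeCycles] P. Deligne (notes by J. S. Milne), Hodge cycles on abelian varieties,
  in: Hodge Cycles, Motives, and Shimura Varieties, LNM 900 (1982), Cor. 4.2, Prop. 4.4, Thm. 4.8
  and its proof pp. 47–52, Remark 4.9.
* [vanGeemen1994HodgeAV] B. van Geemen, An introduction to the Hodge conjecture for abelian
  varieties, LNM 1594 (1994), Lemma 5.2, 5.3–5.4, 5.8–5.11.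
* [MumfordFogartyKirwan1994] D. Mumford, J. Fogarty, F. Kirwan, Geometric Invariant Theory, 3rd ed.
  (1994), Thm. 7.9–7.10.
* [MumfordAV1970] D. Mumford, Abelian Varieties (1970), §19, Remark p. 169.
* [Milne1986AbelianVarieties] J. S. Milne, Abelian Varieties, in: Arithmetic Geometry
  (Cornell–Silverman, eds.), Springer 1986, §8 Prop. 8.1.
* [VoisinHodgeI2002] C. Voisin, Hodge Theory and Complex Algebraic Geometry I, CUP 2002, Thm. 6.32,
  §7.1.2.
* [VoisinHodgeII2003] C. Voisin, Hodge Theory and Complex Algebraic Geometry II, CUP 2003, §3.1.2,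
  Lemma 4.17.
-/

noncomputable section

namespace Literature.AlgebraicGeometry.HodgeTheory

open CategoryTheory _root_.AlgebraicGeometry
open Literature.AlgebraicGeometry Literature.AlgebraicGeometry.Motives
open Literature.AlgebraicTopology.SingularHomology

/-! ### A `K`-linear isogeny from the fibre gives the recorded isogeny pair -/

/-- **The isogeny pair of the reach clause from one `K`-linear isogeny.** If `u : B → A` is an
isogeny of complex abelian varieties intertwining `ψ ∈ End B` and `φ ∈ End A` (`u ≫ φ = ψ ≫ u`),
then `u` is flat and there are `v : A → B` and `m ≥ 1` with `u ≫ v = m • 𝟙 B` and `v ≫ ψ = φ ≫ v`: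
`v` is the quasi-inverse of `u` (Mumford §19, Remark p. 169), isogenies are flat (Milne §8,
Prop. 8.1), and `u ≫ (v ≫ ψ) = m • ψ = u ≫ (φ ≫ v)` with `u` an epimorphism of abelian varieties.
[cite: MumfordAV1970, §19 Remark p. 169] [cite: Milne1986AbelianVarieties, §8 Prop. 8.1] -/
theorem exists_isogenyPair_of_isIsogeny_of_comm {A B : AbelianVariety ℂ} {u : B ⟶ A}
    (hu : AbelianVariety.IsIsogeny u) {φ : A ⟶ A} {ψ : B ⟶ B} (h : u ≫ φ = ψ ≫ u) :
    ∃ (v : A ⟶ B) (m : ℕ), AlgebraicGeometry.Flat u.hom.hom.hom.left ∧ 0 < m ∧ u ≫ v = m • 𝟙 B ∧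
      v ≫ ψ = φ ≫ v := by
  obtain ⟨τ, m, hm, huτ, hτu⟩ := AbelianVariety.IsIsogeny.exists_nsmul_inverse_holds hu
  refine ⟨τ, m, hu.flat, hm, huτ, hu.cancel_left ?_⟩
  rw [← Category.assoc, huτ, ← Category.assoc, h, Category.assoc, huτ, Preadditive.nsmul_comp,
    Preadditive.comp_nsmul, Category.id_comp, Category.comp_id]

/-! ### The construction package implies the unitary-monodromy package -/

/-- **Balanced fibres are not owed by the construction.** Suppose that for all `n, d ≥ 1` and every
hyperbolic `(P, ψ₀, h_K)` (`dim P = 2n`, `ψ₀² = -d`, `h_K = d·e^*a + ψ₀^*e^*a`, `a` rational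
non-zero) there are: (1) a smooth projective family `f : 𝒳 → S` of relative dimension `2n` with a
closed immersion `ι : 𝒳 ↪ ℙᴺ × S` over `S`, `S` irreducible, smooth and quasi-projective, and
`e' : P ≅ 𝒳_{s₀}`; (2) an endomorphism `g` of `𝒳` over `S` (the action of `√-d`,
[Deligne1982HodgeCycles, proof of Thm. 4.8, p. 48]) inducing `ψ₀` on `P` through `e'` and, at every
`s`, the `√-d` `Ψ_s` (`Ψ_s² = -d`) of an abelian `2n`-fold `Y_s` through a chart
`ε_s : Y_s ≅ 𝒳_s` — the fibres of the abelian scheme with its `𝒪_K`-action, with NO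
Hodge-theoretic condition; (4) special-unitary monodromy at `s₀` ("`Γ ⊂ SU`", p. 50;
[vanGeemen1994HodgeAV, 5.11]); (5') every hyperbolic `(A, φ, h_K(A))` of the same `(2n, d)`
receives a `K`-linear ISOGENY `u : Y_s → A` from some fibre chart ([vanGeemen1994HodgeAV, 5.3–5.4,
5.8–5.10]; [Deligne1982HodgeCycles, Cor. 4.2]); (6) a rational `a' ∈ H²(ℙᴺ(ℂ); ℂ)` with
`e'^*((ι_{s₀} ≫ ι ≫ pr₁)^* a') = h_K` ([MumfordFogartyKirwan1994, Thm. 7.9–7.10]; p. 50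
"polarized"). THEN the hypothesis of `polarizedWeilSystem_of_unitaryMonodromyFamily` holds: its
clause (3) — `dim (V₊(Y_s) ∩ H^{1,0}) = n` at EVERY `s` — is derived ("(b) implies (4.4)" at `s₀`
for the hyperbolic `(P, ψ₀)`, `finrank_eigenspace_inf_hodgeOneZero_eq_of_isHyperbolicWeilType`;
constancy of the signature along paths of the connected base,
`finrank_eigenspace_inf_hodgeOneZero_eq_of_path'`; charts `e'`, `ε_s`), and its reach clause (5) —
the pair `(u, v, m)`, `u` flat, `u ≫ v = [m]`, `v` `K`-linear — comes from (5') by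
`exists_isogenyPair_of_isIsogeny_of_comm`.
[cite: Deligne1982HodgeCycles, proof of Thm. 4.8 (pp. 47–52), clauses (a)–(c), with Cor. 4.2 and Prop. 4.4]
[cite: vanGeemen1994HodgeAV, Lemma 5.2 (1) and (4), 5.3–5.4 and 5.8–5.11]
[cite: MumfordFogartyKirwan1994, Thm. 7.9–7.10] [cite: MumfordAV1970, §19 Remark p. 169]
[cite: Milne1986AbelianVarieties, §8 Prop. 8.1] -/
theorem unitaryMonodromyFamily_of_construction
    (h : ∀ (n d : ℕ), 1 ≤ n → 1 ≤ d →
      ∀ (P : AbelianVariety ℂ) (ψ₀ : P ⟶ P) (e : ProjectiveEmbedding P.X)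
        (a : complexBetti (projectiveSpace e.n ℂ) 2),
        P.dim = 2 * n → ψ₀ ≫ ψ₀ = -((d : ℤ) • 𝟙 P) → IsRationalClass a → a ≠ 0 →
        IsHyperbolicWeilType P ψ₀ n
          ((d : ℂ) • complexBetti.map e.ι 2 a +
            complexBetti.map ψ₀.hom.hom.hom 2 (complexBetti.map e.ι 2 a)) →
        ∃ (𝒳 S : SchemeOver ℂ) (f : 𝒳 ⟶ S) (g : 𝒳 ⟶ 𝒳) (s₀ : ComplexPoints S)
          (e' : P.X ≅ fiberOver f s₀)
          (Y : ComplexPoints S → AbelianVariety ℂ) (Ψ : ∀ s, Y s ⟶ Y s)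
          (ε : ∀ s, (Y s).X ≅ fiberOver f s) (N : ℕ)
          (ι : 𝒳 ⟶ CategoryTheory.MonoidalCategoryStruct.tensorObj (projectiveSpace N ℂ) S)
          (a' : complexBetti (projectiveSpace N ℂ) 2),
          IsSmoothProjectiveFamily f (2 * n) ∧
          AlgebraicGeometry.IsClosedImmersion ι.left ∧
          ι ≫ CategoryTheory.CartesianMonoidalCategory.snd (projectiveSpace N ℂ) S = f ∧
          IrreducibleSpace S.left ∧ AlgebraicGeometry.Smooth S.hom ∧ IsQuasiProjectiveOver S ∧
          g ≫ f = f ∧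
          (e'.hom ≫ fiberι f s₀) ≫ g = ψ₀.hom.hom.hom ≫ (e'.hom ≫ fiberι f s₀) ∧
          (∀ s, (Y s).dim = 2 * n ∧ Ψ s ≫ Ψ s = -((d : ℤ) • 𝟙 (Y s)) ∧
            ((ε s).hom ≫ fiberι f s) ≫ g = (Ψ s).hom.hom.hom ≫ ((ε s).hom ≫ fiberι f s)) ∧
          (∀ (hU : IsCohomologicallyLocallyTrivialOn f (Set.univ : Set (ComplexPoints S)))
              (g₀ : fiberOver f s₀ ⟶ fiberOver f s₀), g₀ ≫ fiberι f s₀ = fiberι f s₀ ≫ g →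
            ∀ (γ : Path.Homotopic.Quotient
                (⟨s₀, Set.mem_univ s₀⟩ : (Set.univ : Set (ComplexPoints S))) ⟨s₀, Set.mem_univ s₀⟩)
              (μ : ℂ), (μ = Complex.I * (Real.sqrt d : ℂ) ∨ μ = -(Complex.I * (Real.sqrt d : ℂ))) →
            ∀ hμ : ∀ v ∈ Module.End.eigenspace (complexBetti.map g₀ 1).hom μ,
                transportLinear f 1 hU γ v ∈ Module.End.eigenspace (complexBetti.map g₀ 1).hom μ,
              LinearMap.det ((transportLinear f 1 hU γ).restrict hμ) = 1) ∧
          (∀ (A : AbelianVariety ℂ) (φ : A ⟶ A) (eA : ProjectiveEmbedding A.X)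
            (aA : complexBetti (projectiveSpace eA.n ℂ) 2),
            A.dim = 2 * n → φ ≫ φ = -((d : ℤ) • 𝟙 A) → IsRationalClass aA → aA ≠ 0 →
            IsHyperbolicWeilType A φ n
              ((d : ℂ) • complexBetti.map eA.ι 2 aA +
                complexBetti.map φ.hom.hom.hom 2 (complexBetti.map eA.ι 2 aA)) →
            ∃ (s : ComplexPoints S) (u : Y s ⟶ A),
              AbelianVariety.IsIsogeny u ∧ u ≫ φ = Ψ s ≫ u) ∧
          IsRationalClass a' ∧
          complexBetti.map e'.hom 2 (complexBetti.map (fiberι f s₀) 2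
            (complexBetti.map
              (ι ≫ CategoryTheory.CartesianMonoidalCategory.fst (projectiveSpace N ℂ) S) 2 a')) =
            (d : ℂ) • complexBetti.map e.ι 2 a +
              complexBetti.map ψ₀.hom.hom.hom 2 (complexBetti.map e.ι 2 a)) :
    ∀ (n d : ℕ), 1 ≤ n → 1 ≤ d →
      ∀ (P : AbelianVariety ℂ) (ψ₀ : P ⟶ P) (e : ProjectiveEmbedding P.X)
        (a : complexBetti (projectiveSpace e.n ℂ) 2),
        P.dim = 2 * n → ψ₀ ≫ ψ₀ = -((d : ℤ) • 𝟙 P) → IsRationalClass a → a ≠ 0 →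
        IsHyperbolicWeilType P ψ₀ n
          ((d : ℂ) • complexBetti.map e.ι 2 a +
            complexBetti.map ψ₀.hom.hom.hom 2 (complexBetti.map e.ι 2 a)) →
        ∃ (𝒳 S : SchemeOver ℂ) (f : 𝒳 ⟶ S) (g : 𝒳 ⟶ 𝒳) (s₀ : ComplexPoints S)
          (e' : P.X ≅ fiberOver f s₀)
          (Y : ComplexPoints S → AbelianVariety ℂ) (Ψ : ∀ s, Y s ⟶ Y s)
          (ε : ∀ s, (Y s).X ≅ fiberOver f s) (N : ℕ)
          (ι : 𝒳 ⟶ CategoryTheory.MonoidalCategoryStruct.tensorObj (projectiveSpace N ℂ) S)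
          (a' : complexBetti (projectiveSpace N ℂ) 2),
          IsSmoothProjectiveFamily f (2 * n) ∧
          AlgebraicGeometry.IsClosedImmersion ι.left ∧
          ι ≫ CategoryTheory.CartesianMonoidalCategory.snd (projectiveSpace N ℂ) S = f ∧
          IrreducibleSpace S.left ∧ AlgebraicGeometry.Smooth S.hom ∧ IsQuasiProjectiveOver S ∧
          g ≫ f = f ∧
          (e'.hom ≫ fiberι f s₀) ≫ g = ψ₀.hom.hom.hom ≫ (e'.hom ≫ fiberι f s₀) ∧
          (∀ s, (Y s).dim = 2 * n ∧ Ψ s ≫ Ψ s = -((d : ℤ) • 𝟙 (Y s)) ∧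
            ((ε s).hom ≫ fiberι f s) ≫ g = (Ψ s).hom.hom.hom ≫ ((ε s).hom ≫ fiberι f s) ∧
            ∀ hY : IsSmoothProjective (2 * n) (Y s).X,
              Module.finrank ℂ
                ↥(Module.End.eigenspace (complexBetti.map (Ψ s).hom.hom.hom 1).hom
                    (Complex.I * (Real.sqrt d : ℂ)) ⊓ hodgeOneZero hY) = n) ∧
          (∀ (hU : IsCohomologicallyLocallyTrivialOn f (Set.univ : Set (ComplexPoints S)))
              (g₀ : fiberOver f s₀ ⟶ fiberOver f s₀), g₀ ≫ fiberι f s₀ = fiberι f s₀ ≫ g →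
            ∀ (γ : Path.Homotopic.Quotient
                (⟨s₀, Set.mem_univ s₀⟩ : (Set.univ : Set (ComplexPoints S))) ⟨s₀, Set.mem_univ s₀⟩)
              (μ : ℂ), (μ = Complex.I * (Real.sqrt d : ℂ) ∨ μ = -(Complex.I * (Real.sqrt d : ℂ))) →
            ∀ hμ : ∀ v ∈ Module.End.eigenspace (complexBetti.map g₀ 1).hom μ,
                transportLinear f 1 hU γ v ∈ Module.End.eigenspace (complexBetti.map g₀ 1).hom μ,
              LinearMap.det ((transportLinear f 1 hU γ).restrict hμ) = 1) ∧
          (∀ (A : AbelianVariety ℂ) (φ : A ⟶ A) (eA : ProjectiveEmbedding A.X)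
            (aA : complexBetti (projectiveSpace eA.n ℂ) 2),
            A.dim = 2 * n → φ ≫ φ = -((d : ℤ) • 𝟙 A) → IsRationalClass aA → aA ≠ 0 →
            IsHyperbolicWeilType A φ n
              ((d : ℂ) • complexBetti.map eA.ι 2 aA +
                complexBetti.map φ.hom.hom.hom 2 (complexBetti.map eA.ι 2 aA)) →
            ∃ (s : ComplexPoints S) (u : Y s ⟶ A) (v : A ⟶ Y s) (m : ℕ),
              AlgebraicGeometry.Flat u.hom.hom.hom.left ∧ 0 < m ∧ u ≫ v = m • 𝟙 (Y s) ∧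
                v ≫ Ψ s = φ ≫ v) ∧
          IsRationalClass a' ∧
          complexBetti.map e'.hom 2 (complexBetti.map (fiberι f s₀) 2
            (complexBetti.map
              (ι ≫ CategoryTheory.CartesianMonoidalCategory.fst (projectiveSpace N ℂ) S) 2 a')) =
            (d : ℂ) • complexBetti.map e.ι 2 a +
              complexBetti.map ψ₀.hom.hom.hom 2 (complexBetti.map e.ι 2 a) := by
  intro n d hn hd P ψ₀ e a hP hψ ha ha0 hhyp
  obtain ⟨𝒳, S, f, g, s₀, e', Y, Ψ, ε, N, ι, a', hfam, hιci, hιf, hirr, hsm, hqp, hg, he', hfib,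
    hdet, hreach, ha', hH₀⟩ := h n d hn hd P ψ₀ e a hP hψ ha ha0 hhyp
  have hn0 : 0 < n := hn
  have hd0 : 0 < d := hd
  have hψ' : ψ₀ ≫ ψ₀ = -(d • 𝟙 P) := by rw [hψ, natCast_zsmul]
  -- the base: `S(ℂ)` is a path-connected manifold and `R• f_* ℂ` is a local system on it
  haveI := hsm
  haveI := hirr
  haveI : LocallyOfFiniteType S.hom := hqp.locallyOfFiniteType
  haveI : ConnectedSpace (ComplexPoints S) :=
    (Motives.ComplexPoints.connectedSpace_iff_holds S).2 inferInstance
  obtain ⟨dS, hdS⟩ := exists_smoothOfRelativeDimension_of_connectedSpace_complexPoints S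
  haveI := hdS
  haveI := pathConnectedSpace_complexPoints_of_smoothOfRelativeDimension S dS
  have hU := isCohomologicallyLocallyTrivialOn_univ_of_isSmoothProjectiveFamily f dS hfam hqp
  -- the fibre maps of `g`, the fibres, one projective space containing all of them
  have hgf' := fun t ↦ exists_fiberHom_comp_fiberι f g hg t
  choose gf hgf using hgf'
  have hsp : ∀ t : ComplexPoints S, IsSmoothProjective (2 * n) (fiberOver f t) :=
    fun t ↦ hfam.isSmoothProjective t
  have hemb : ∃ (N : ℕ) (ι : 𝒳 ⟶ CategoryTheory.MonoidalCategoryStruct.tensorObj (projectiveSpace N ℂ) S),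
      AlgebraicGeometry.IsClosedImmersion ι.left ∧
        ι ≫ CategoryTheory.CartesianMonoidalCategory.snd (projectiveSpace N ℂ) S = f :=
    ⟨N, ι, hιci, hιf⟩
  obtain ⟨m, εm, hεm⟩ := exists_forall_isClosedImmersion_fiberι_comp f hfam hemb hqp
  -- balanced at `s₀`: "(b) implies (4.4)" for the hyperbolic `(P, ψ₀)`, read through `e'`
  set μ : ℂ := Complex.I * (Real.sqrt d : ℂ) with hμ
  have he₀ : e'.hom ≫ gf s₀ = ψ₀.hom.hom.hom ≫ e'.hom :=
    hom_comp_fiberHom_eq_of_comp_fiberι f g (hgf s₀) e' ψ₀.hom.hom.hom he'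
  have hE₀ : Module.finrank ℂ ↥(Module.End.eigenspace (complexBetti.map (gf s₀) 1).hom μ) = 2 * n := by
    rw [finrank_eigenspace_eq_of_iso e' (gf s₀) he₀ μ 1]
    have h2 := two_mul_finrank_eigenspace_eq hd0 hψ'
    rw [Motives.AbelianVariety.finrank_complexBetti_one, hP, ← hμ] at h2
    omega
  have hbal₀ : Module.finrank ℂ ↥(Module.End.eigenspace (complexBetti.map (gf s₀) 1).hom μ ⊓
      hodgeOneZero (hsp s₀)) = n := by
    rw [finrank_eigenspace_inf_hodgeOneZero_eq_of_iso hP (hsp s₀) e' (gf s₀) he₀ μ]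
    exact finrank_eigenspace_inf_hodgeOneZero_eq_of_isHyperbolicWeilType hn0 hd0 hP hψ' e ha ha0 hhyp
  refine ⟨𝒳, S, f, g, s₀, e', Y, Ψ, ε, N, ι, a', hfam, hιci, hιf, hirr, hsm, hqp, hg, he',
    fun s ↦ ?_, hdet, ?_, ha', hH₀⟩
  · -- clause (3) at `s`: propagate along a path from `s₀`, then read through the chart `ε_s`
    obtain ⟨hYd, hΨ, hεc⟩ := hfib s
    refine ⟨hYd, hΨ, hεc, fun hY ↦ ?_⟩
    have hes : (ε s).hom ≫ gf s = (Ψ s).hom.hom.hom ≫ (ε s).hom :=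
      hom_comp_fiberHom_eq_of_comp_fiberι f g (hgf s) (ε s) (Ψ s).hom.hom.hom hεc
    let γ : Path (⟨s₀, Set.mem_univ s₀⟩ : (Set.univ : Set (ComplexPoints S))) ⟨s, Set.mem_univ s⟩ :=
      (PathConnectedSpace.somePath s₀ s).map (continuous_id.subtype_mk _)
    have hbal : Module.finrank ℂ ↥(Module.End.eigenspace (complexBetti.map (gf s) 1).hom μ ⊓
        hodgeOneZero (hsp s)) = n :=
      finrank_eigenspace_inf_hodgeOneZero_eq_of_path' f (by omega) hsp hU g hg gf hgf μ εm hεm ⟦γ⟧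
        hE₀ hbal₀
    have hchart := finrank_eigenspace_inf_hodgeOneZero_eq_of_iso hYd (hsp s) (ε s) (gf s) hes μ
    rw [hbal] at hchart
    obtain rfl : hY = Motives.isSmoothProjective_of_dim_eq' hYd := rfl
    exact hchart.symm
  · -- clause (5): the isogeny pair from the `K`-linear isogeny
    intro A φ eA aA hA hφ haA haA0 hhypA
    obtain ⟨s, u, hu, huφ⟩ := hreach A φ eA aA hA hφ haA haA0 hhypA
    obtain ⟨v, m', hfl, hm', huv, hv⟩ := exists_isogenyPair_of_isIsogeny_of_comm hu huφ
    exact ⟨s, u, v, m', hfl, hm', huv, hv⟩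

/-! ### Hence both named facts from the bare construction -/

/-- **`weilFamilyReach_hyperbolic` from the bare construction** (the hypothesis of
`unitaryMonodromyFamily_of_construction`, stated inline: family, global `√-d` with charts,
special-unitary monodromy at `s₀`, reach by a `K`-linear isogeny, the polarization equation at
`s₀`; NO balanced-type or Hodge-type clause): `unitaryMonodromyFamily_of_construction` followed by
`weilFamilyReach_hyperbolic_of_unitaryMonodromyFamily`.
[cite: Deligne1982HodgeCycles, proof of Thm. 4.8 (pp. 47–52) with Cor. 4.2 and Prop. 4.4]
[cite: vanGeemen1994HodgeAV, Lemma 5.2, 5.3–5.4 and 5.8–5.11]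
[cite: MumfordFogartyKirwan1994, Thm. 7.9–7.10] [cite: Milne1986AbelianVarieties, §8 Prop. 8.1] -/
theorem weilFamilyReach_hyperbolic_of_construction
    (h : ∀ (n d : ℕ), 1 ≤ n → 1 ≤ d →
      ∀ (P : AbelianVariety ℂ) (ψ₀ : P ⟶ P) (e : ProjectiveEmbedding P.X)
        (a : complexBetti (projectiveSpace e.n ℂ) 2),
        P.dim = 2 * n → ψ₀ ≫ ψ₀ = -((d : ℤ) • 𝟙 P) → IsRationalClass a → a ≠ 0 →
        IsHyperbolicWeilType P ψ₀ n
          ((d : ℂ) • complexBetti.map e.ι 2 a +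
            complexBetti.map ψ₀.hom.hom.hom 2 (complexBetti.map e.ι 2 a)) →
        ∃ (𝒳 S : SchemeOver ℂ) (f : 𝒳 ⟶ S) (g : 𝒳 ⟶ 𝒳) (s₀ : ComplexPoints S)
          (e' : P.X ≅ fiberOver f s₀)
          (Y : ComplexPoints S → AbelianVariety ℂ) (Ψ : ∀ s, Y s ⟶ Y s)
          (ε : ∀ s, (Y s).X ≅ fiberOver f s) (N : ℕ)
          (ι : 𝒳 ⟶ CategoryTheory.MonoidalCategoryStruct.tensorObj (projectiveSpace N ℂ) S)
          (a' : complexBetti (projectiveSpace N ℂ) 2),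
          IsSmoothProjectiveFamily f (2 * n) ∧
          AlgebraicGeometry.IsClosedImmersion ι.left ∧
          ι ≫ CategoryTheory.CartesianMonoidalCategory.snd (projectiveSpace N ℂ) S = f ∧
          IrreducibleSpace S.left ∧ AlgebraicGeometry.Smooth S.hom ∧ IsQuasiProjectiveOver S ∧
          g ≫ f = f ∧
          (e'.hom ≫ fiberι f s₀) ≫ g = ψ₀.hom.hom.hom ≫ (e'.hom ≫ fiberι f s₀) ∧
          (∀ s, (Y s).dim = 2 * n ∧ Ψ s ≫ Ψ s = -((d : ℤ) • 𝟙 (Y s)) ∧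
            ((ε s).hom ≫ fiberι f s) ≫ g = (Ψ s).hom.hom.hom ≫ ((ε s).hom ≫ fiberι f s)) ∧
          (∀ (hU : IsCohomologicallyLocallyTrivialOn f (Set.univ : Set (ComplexPoints S)))
              (g₀ : fiberOver f s₀ ⟶ fiberOver f s₀), g₀ ≫ fiberι f s₀ = fiberι f s₀ ≫ g →
            ∀ (γ : Path.Homotopic.Quotient
                (⟨s₀, Set.mem_univ s₀⟩ : (Set.univ : Set (ComplexPoints S))) ⟨s₀, Set.mem_univ s₀⟩)
              (μ : ℂ), (μ = Complex.I * (Real.sqrt d : ℂ) ∨ μ = -(Complex.I * (Real.sqrt d : ℂ))) →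
            ∀ hμ : ∀ v ∈ Module.End.eigenspace (complexBetti.map g₀ 1).hom μ,
                transportLinear f 1 hU γ v ∈ Module.End.eigenspace (complexBetti.map g₀ 1).hom μ,
              LinearMap.det ((transportLinear f 1 hU γ).restrict hμ) = 1) ∧
          (∀ (A : AbelianVariety ℂ) (φ : A ⟶ A) (eA : ProjectiveEmbedding A.X)
            (aA : complexBetti (projectiveSpace eA.n ℂ) 2),
            A.dim = 2 * n → φ ≫ φ = -((d : ℤ) • 𝟙 A) → IsRationalClass aA → aA ≠ 0 →
            IsHyperbolicWeilType A φ n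
              ((d : ℂ) • complexBetti.map eA.ι 2 aA +
                complexBetti.map φ.hom.hom.hom 2 (complexBetti.map eA.ι 2 aA)) →
            ∃ (s : ComplexPoints S) (u : Y s ⟶ A),
              AbelianVariety.IsIsogeny u ∧ u ≫ φ = Ψ s ≫ u) ∧
          IsRationalClass a' ∧
          complexBetti.map e'.hom 2 (complexBetti.map (fiberι f s₀) 2
            (complexBetti.map
              (ι ≫ CategoryTheory.CartesianMonoidalCategory.fst (projectiveSpace N ℂ) S) 2 a')) =
            (d : ℂ) • complexBetti.map e.ι 2 a +
              complexBetti.map ψ₀.hom.hom.hom 2 (complexBetti.map e.ι 2 a)) :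
    weilFamilyReach_hyperbolic :=
  weilFamilyReach_hyperbolic_of_unitaryMonodromyFamily (unitaryMonodromyFamily_of_construction h)

/-- **`weilFamily_hyperbolic_weilSystem_reach` from the bare construction** (same hypothesis;
`unitaryMonodromyFamily_of_construction` followed by
`weilFamily_hyperbolic_weilSystem_reach_of_unitaryMonodromyFamily`).
[cite: Deligne1982HodgeCycles, proof of Thm. 4.8 (pp. 47–52) with Cor. 4.2 and Prop. 4.4]
[cite: vanGeemen1994HodgeAV, Lemma 5.2, 5.3–5.4 and 5.8–5.11] -/
theorem weilFamily_hyperbolic_weilSystem_reach_of_construction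
    (h : ∀ (n d : ℕ), 1 ≤ n → 1 ≤ d →
      ∀ (P : AbelianVariety ℂ) (ψ₀ : P ⟶ P) (e : ProjectiveEmbedding P.X)
        (a : complexBetti (projectiveSpace e.n ℂ) 2),
        P.dim = 2 * n → ψ₀ ≫ ψ₀ = -((d : ℤ) • 𝟙 P) → IsRationalClass a → a ≠ 0 →
        IsHyperbolicWeilType P ψ₀ n
          ((d : ℂ) • complexBetti.map e.ι 2 a +
            complexBetti.map ψ₀.hom.hom.hom 2 (complexBetti.map e.ι 2 a)) →
        ∃ (𝒳 S : SchemeOver ℂ) (f : 𝒳 ⟶ S) (g : 𝒳 ⟶ 𝒳) (s₀ : ComplexPoints S)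
          (e' : P.X ≅ fiberOver f s₀)
          (Y : ComplexPoints S → AbelianVariety ℂ) (Ψ : ∀ s, Y s ⟶ Y s)
          (ε : ∀ s, (Y s).X ≅ fiberOver f s) (N : ℕ)
          (ι : 𝒳 ⟶ CategoryTheory.MonoidalCategoryStruct.tensorObj (projectiveSpace N ℂ) S)
          (a' : complexBetti (projectiveSpace N ℂ) 2),
          IsSmoothProjectiveFamily f (2 * n) ∧
          AlgebraicGeometry.IsClosedImmersion ι.left ∧
          ι ≫ CategoryTheory.CartesianMonoidalCategory.snd (projectiveSpace N ℂ) S = f ∧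
          IrreducibleSpace S.left ∧ AlgebraicGeometry.Smooth S.hom ∧ IsQuasiProjectiveOver S ∧
          g ≫ f = f ∧
          (e'.hom ≫ fiberι f s₀) ≫ g = ψ₀.hom.hom.hom ≫ (e'.hom ≫ fiberι f s₀) ∧
          (∀ s, (Y s).dim = 2 * n ∧ Ψ s ≫ Ψ s = -((d : ℤ) • 𝟙 (Y s)) ∧
            ((ε s).hom ≫ fiberι f s) ≫ g = (Ψ s).hom.hom.hom ≫ ((ε s).hom ≫ fiberι f s)) ∧
          (∀ (hU : IsCohomologicallyLocallyTrivialOn f (Set.univ : Set (ComplexPoints S)))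
              (g₀ : fiberOver f s₀ ⟶ fiberOver f s₀), g₀ ≫ fiberι f s₀ = fiberι f s₀ ≫ g →
            ∀ (γ : Path.Homotopic.Quotient
                (⟨s₀, Set.mem_univ s₀⟩ : (Set.univ : Set (ComplexPoints S))) ⟨s₀, Set.mem_univ s₀⟩)
              (μ : ℂ), (μ = Complex.I * (Real.sqrt d : ℂ) ∨ μ = -(Complex.I * (Real.sqrt d : ℂ))) →
            ∀ hμ : ∀ v ∈ Module.End.eigenspace (complexBetti.map g₀ 1).hom μ,
                transportLinear f 1 hU γ v ∈ Module.End.eigenspace (complexBetti.map g₀ 1).hom μ,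
              LinearMap.det ((transportLinear f 1 hU γ).restrict hμ) = 1) ∧
          (∀ (A : AbelianVariety ℂ) (φ : A ⟶ A) (eA : ProjectiveEmbedding A.X)
            (aA : complexBetti (projectiveSpace eA.n ℂ) 2),
            A.dim = 2 * n → φ ≫ φ = -((d : ℤ) • 𝟙 A) → IsRationalClass aA → aA ≠ 0 →
            IsHyperbolicWeilType A φ n
              ((d : ℂ) • complexBetti.map eA.ι 2 aA +
                complexBetti.map φ.hom.hom.hom 2 (complexBetti.map eA.ι 2 aA)) →
            ∃ (s : ComplexPoints S) (u : Y s ⟶ A),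
              AbelianVariety.IsIsogeny u ∧ u ≫ φ = Ψ s ≫ u) ∧
          IsRationalClass a' ∧
          complexBetti.map e'.hom 2 (complexBetti.map (fiberι f s₀) 2
            (complexBetti.map
              (ι ≫ CategoryTheory.CartesianMonoidalCategory.fst (projectiveSpace N ℂ) S) 2 a')) =
            (d : ℂ) • complexBetti.map e.ι 2 a +
              complexBetti.map ψ₀.hom.hom.hom 2 (complexBetti.map e.ι 2 a)) :
    weilFamily_hyperbolic_weilSystem_reach :=
  weilFamily_hyperbolic_weilSystem_reach_of_unitaryMonodromyFamily
    (unitaryMonodromyFamily_of_construction h)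

end Literature.AlgebraicGeometry.HodgeTheory
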